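import Summits.BirchSwinnertonDyer.BirchSwinnertonDyer.Theorems.PrintCFramBottomClassIndexLawFiveLeCohenCutCarlitzLevelOne
import HarnessLib

/-!
# Crux `PrintCFram.BottomClassIndexLawFiveLe` (stmt-BirchSwinnertonDyer-20372), line `eisenstein-resource-bdp-line` (registry v29):
# `L(1 − k, χ_D)` IS `p`-INTEGRAL FOR EVERY FUNDAMENTAL DISCRIMINANT `D` — Carlitz / Lang at an arbitrary Kronecker symbol
# (cell `bsd-print-cfram`, width seat `bsd-line-cfram-p1-w2` g15; THEOREMS ONLY, `--supports` 20372; BSD is not proved by any of this)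

HONEST FRAMING. Nothing here is a statement about BSD; no registered stub is closed by this file alone. This is the first half of the
discharge of (HInt⁶) — «every Cohen number `H(k, n)` is `p`-integral at the six leaf primes» — the one hypothesis of the CITE ROAD
`FlipRung.rungAll_six_of_raum` (w2 g15, `…FlipRungRaumCoupling`: Raum 2023 Prop. 2.3 needs ALL Fourier coefficients of Cohen's `H_k` in
`O_{K,ℓ}`, not only those on the class cut, which w4 g12 / w7 g6 made integral in `…CohenCutIntegrality` / `…CohenCutCarlitz(LevelOne)`).
Here: for an odd prime `p` and ANY fundamental discriminant `D` (`D ≡ 1 (mod 4)` squarefree, or `D = 4D'`, `D' ≡ 2, 3 (mod 4)`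
squarefree; BOTH signs, BOTH parities), the value `L(1 − k, χ_D) = −B_{k,χ_D}/k = lValueDisc k D` is `p`-integral for `2 ≤ k ≤ p − 2`,
`(p − 1) ∤ 2k` — by Lang's measure `χ_D E_{k,c}` (the tree's `CarlitzIntegrality`, any level) fed with the INTEGER Kronecker symbol
`χ_D = chiDisc D` and an auxiliary `c`:
* `p ∤ D`: `c ≡ 1 (mod |D|)`, `c ≡ g (mod p)` a primitive root (`CharacterTwist.exists_auxiliary`): `χ_D(c) = 1`, `1 − c^k` a unit;
* `p ∣ D`, `D < 0` odd: the tree's `CohenCut.norm_lValueDisc_neg_le_one_of_dvd_of_not_dvd` (covers `D = −p`, where `(p−1) ∤ k, 2k` matters);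
* `p ∣ D`, `D > 0` odd: `D = p·n`, `n ≡ 3 (mod 4)`; `c ≡ 1 (mod p)`, `c ≡ −1 (mod n)`: `χ_D(c) = J(c|p)J(c|n) = −1`, `1 + c^k ≡ 2` a unit;
* `p ∣ D`, `D = 4D'`, `D' ≡ 3 (mod 4)`: `c ≡ 1 (mod |D'|)`, `c ≡ 3 (mod 4)`: `χ_D(c) = χ₄(c)·J(c | |D'|) = −1`;
* `p ∣ D`, `D = 8D''`, `D''` odd: `c ≡ 1 (mod |D''|)`, `c ≡ 5 (mod 8)`: `χ_D(c) = χ₈(c)·χ₄(c)^{[D'' ≡ 3 (4)]}·J(c | |D''|) = −1`.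
§1 `chiDisc D` is `|D|`-periodic and multiplicative at odd arguments; §2 the bridge to `CarlitzIntegrality`; §3 the cases; §4
**`norm_lValueDisc_le_one_of_isDisc`** (every `D` of `IsDiscDecomposition`, `D = 1` included). The companion `…CohenIntegralityAllIndices`
assembles `‖H(k, n)‖_p ≤ 1` and (HInt⁶). beyond-print theorem: NO. References: [Carlitz1959]; [LangCyclotomic1990] Ch. 2 §2 Thm 2.4;
[Washington1997] Thm. 5.11, Cor. 5.15; [MontgomeryVaughan2007] Thm. 9.13; [Cohen1975] §2.
-/

set_option autoImplicit false
-- summit-side namespace `Summit.BirchSwinnertonDyer.BirchSwinnertonDyer.…` (single-conjunct summit, D-0017 layout)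
set_option linter.dupNamespace false

noncomputable section

open scoped Classical NumberTheorySymbols
open NumberField DirichletCharacter
open Literature.NumberTheory.LFunctions Literature.NumberTheory.ModularForms.CohenEisenstein Literature.NumberTheory.EllipticCurves
  Literature.NumberTheory.Congruences Literature.NumberTheory.QuadraticFields

namespace Summit.BirchSwinnertonDyer.BirchSwinnertonDyer.Theorems.PrintCFram.CohenCut

open Summit.BirchSwinnertonDyer.BirchSwinnertonDyer.Theorems.PrintCFram

variable {p : ℕ} [hp : Fact p.Prime]

/-! ## §1 The Kronecker symbol of a fundamental discriminant: periodic modulo `|D|`, multiplicative at odd arguments -/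

omit hp in
/-- For `4 ∣ D` and odd `n`: `J(D | n) = J(D/4 | n)` (`J(4 | n) = J(2 | n)² = 1`). [cite: MontgomeryVaughan2007, Thm. 9.13] -/
theorem jacobiSym_four_mul_of_odd (D' : ℤ) {n : ℕ} (hn : Odd n) : J(4 * D' | n) = J(D' | n) := by
  have h2n : Nat.Coprime 2 n :=
    Nat.prime_two.coprime_iff_not_dvd.mpr fun h => (Nat.not_even_iff_odd.mpr hn) (even_iff_two_dvd.mpr h)
  have h2 : J(2 | n) ^ 2 = 1 := jacobiSym.sq_one (by exact_mod_cast h2n)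
  rw [show (4 : ℤ) * D' = 2 * 2 * D' by ring, jacobiSym.mul_left, jacobiSym.mul_left, ← pow_two, h2, one_mul]

omit hp in
/-- **`χ_D` is `|D|`-periodic** (`D ≡ 1 (mod 4)` or `4 ∣ D`, `D ≠ 0`). [cite: MontgomeryVaughan2007, Thm. 9.13] -/
theorem chiDisc_add_natAbs {D : ℤ} (hD : D % 4 = 1 ∨ 4 ∣ D) (hD0 : D ≠ 0) (b : ℕ) :
    chiDisc D (b + D.natAbs) = chiDisc D b := by
  rcases hD with hD | hD
  · rw [chiDisc_of_emod_four_eq_one hD, chiDisc_of_emod_four_eq_one hD, jacobiSym.mod_left ((b + D.natAbs : ℕ) : ℤ),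
      jacobiSym.mod_left (b : ℤ)]
    congr 1
    push_cast
    rw [show ((b : ℤ)) + |D| = b + |D| * 1 by ring, Int.add_mul_emod_self_left]
  · have hD1 : D % 4 ≠ 1 := by have := Int.emod_emod_of_dvd D (show (4 : ℤ) ∣ 4 from dvd_rfl); omega
    obtain ⟨D', rfl⟩ := hD
    have hDabs : (4 * D').natAbs = 4 * D'.natAbs := by rw [Int.natAbs_mul]; rfl
    have heven : Even (4 * D').natAbs := ⟨2 * D'.natAbs, by rw [hDabs]; ring⟩
    rcases Nat.even_or_odd b with hb | hb
    · rw [chiDisc_of_emod_four_ne_one_of_even hD1 hb, chiDisc_of_emod_four_ne_one_of_even hD1 (hb.add heven)]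
    · have hb' : Odd (b + (4 * D').natAbs) := hb.add_even heven
      rw [chiDisc_of_emod_four_ne_one_of_odd hD1 hb, chiDisc_of_emod_four_ne_one_of_odd hD1 hb',
        jacobiSym_four_mul_of_odd D' hb, jacobiSym_four_mul_of_odd D' hb', jacobiSym.mod_right D' hb,
        jacobiSym.mod_right D' hb', hDabs, Nat.add_mod_right]

omit hp in
/-- `χ_D(b % |D|) = χ_D(b)` (iterated periodicity). [cite: MontgomeryVaughan2007, Thm. 9.13] -/
theorem chiDisc_mod_natAbs {D : ℤ} (hD : D % 4 = 1 ∨ 4 ∣ D) (hD0 : D ≠ 0) (b : ℕ) :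
    chiDisc D (b % D.natAbs) = chiDisc D b := by
  have key : ∀ j r : ℕ, chiDisc D (r + D.natAbs * j) = chiDisc D r := by
    intro j; induction j with
    | zero => intro r; rw [mul_zero, add_zero]
    | succ j ih => intro r; rw [Nat.mul_succ, ← add_assoc, chiDisc_add_natAbs hD hD0, ih]
  conv_rhs => rw [← Nat.mod_add_div b D.natAbs]
  exact (key (b / D.natAbs) (b % D.natAbs)).symm

omit hp in
/-- **`χ_D(c·x) = χ_D(c)·χ_D(x)`** when `D ≡ 1 (mod 4)`, or `4 ∣ D` and `c` is odd. [cite: MontgomeryVaughan2007, Thm. 9.13] -/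
theorem chiDisc_mul_right {D : ℤ} {c : ℕ} (hc : D % 4 = 1 ∨ Odd c) (x : ℕ) :
    chiDisc D (c * x) = chiDisc D c * chiDisc D x := by
  by_cases h1 : D % 4 = 1
  · rw [chiDisc_of_emod_four_eq_one h1, chiDisc_of_emod_four_eq_one h1, chiDisc_of_emod_four_eq_one h1, Nat.cast_mul,
      jacobiSym.mul_left]
  · have hco : Odd c := hc.resolve_left h1
    rcases Nat.even_or_odd x with hx | hx
    · rw [chiDisc_of_emod_four_ne_one_of_even h1 hx, chiDisc_of_emod_four_ne_one_of_even h1 (hx.mul_left c), mul_zero]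
    · haveI : NeZero c := ⟨by rintro rfl; exact (Nat.not_even_iff_odd.mpr hco) Even.zero⟩
      haveI : NeZero x := ⟨by rintro rfl; exact (Nat.not_even_iff_odd.mpr hx) Even.zero⟩
      rw [chiDisc_of_emod_four_ne_one_of_odd h1 hco, chiDisc_of_emod_four_ne_one_of_odd h1 hx,
        chiDisc_of_emod_four_ne_one_of_odd h1 (hco.mul hx), jacobiSym.mul_right]

/-! ## §2 The bridge: Lang's measure with the integer Kronecker symbol -/

/-- **`‖L(1−k, χ_D)‖_p ≤ 1` from an auxiliary unit.** For an odd prime `p`, `D ≡ 1 (mod 4)` or `4 ∣ D` (`D ≠ 0`), `k ≥ 1`, and `c` prime to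
`|D|·p` (odd if `4 ∣ D`) with `1 − χ_D(c)c^k` a `p`-adic unit: `‖lValueDisc k D‖_p ≤ 1` (Lang's Thm 2.4 for the measure `χ_D E_{k,c}` at level
`|D|`, the tree's `CarlitzIntegrality.norm_sum_mul_bernoulliDist_div_le_one_of_unit`). [cite: LangCyclotomic1990, Ch. 2 §2, Thm. 2.4] -/
theorem norm_lValueDisc_le_one_of_unit (hp2 : p ≠ 2) {D : ℤ} (hD : D % 4 = 1 ∨ 4 ∣ D) (hD0 : D ≠ 0) {k c : ℕ} (hk : 1 ≤ k)
    (hc : c.Coprime (D.natAbs * p)) (hco : D % 4 = 1 ∨ Odd c)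
    (hu : ‖1 - ((chiDisc D c : ℤ) : ℚ_[p]) * (c : ℚ_[p]) ^ k‖ = 1) :
    ‖((lValueDisc k D : ℚ) : ℚ_[p])‖ ≤ 1 := by
  haveI : NeZero D.natAbs := ⟨Int.natAbs_ne_zero.mpr hD0⟩
  set θ : ℕ → ℤ_[p] := fun b ↦ ((chiDisc D b : ℤ) : ℤ_[p]) with hθ_def
  have hθ : ∀ b, θ (b + D.natAbs) = θ b := fun b ↦ by simp only [hθ_def, chiDisc_add_natAbs hD hD0]
  have hθc : ∀ x, θ (c * x) = θ c * θ x := fun x ↦ by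
    simp only [hθ_def, chiDisc_mul_right hco]; push_cast; ring
  have hu' : ‖1 - ((θ c : ℤ_[p]) : ℚ_[p]) * (c : ℚ_[p]) ^ k‖ = 1 := by
    simpa only [hθ_def, PadicInt.coe_intCast] using hu
  have h := CarlitzIntegrality.norm_sum_mul_bernoulliDist_div_le_one_of_unit hp2 hc hθ hθc hk hu'
  have hsum : ∑ b : ZMod D.natAbs, ((θ b.val : ℤ_[p]) : ℚ_[p]) * ((bernoulliDist k D.natAbs b : ℚ) : ℚ_[p]) =
      ((bernoulliDisc k D : ℚ) : ℚ_[p]) := by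
    rw [ratCast_bernoulliDisc_eq_sum hk D]
    refine Finset.sum_congr rfl fun b _ => ?_
    simp only [hθ_def, PadicInt.coe_intCast]
  have hkp : ‖(k : ℚ_[p])‖ ≠ 0 := by
    rw [norm_ne_zero_iff]; exact_mod_cast (show k ≠ 0 by omega)
  rw [hsum] at h
  rw [lValueDisc, Rat.cast_div, Rat.cast_neg, Rat.cast_natCast, norm_div, norm_neg, div_le_one (lt_of_le_of_ne (norm_nonneg _) hkp.symm)]
  rw [norm_mul, norm_inv] at h
  have hk0 : 0 < ‖(k : ℚ_[p])‖ := lt_of_le_of_ne (norm_nonneg _) hkp.symm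
  calc ‖((bernoulliDisc k D : ℚ) : ℚ_[p])‖ = ‖(k : ℚ_[p])‖ * (‖(k : ℚ_[p])‖⁻¹ * ‖((bernoulliDisc k D : ℚ) : ℚ_[p])‖) := by
        field_simp
    _ ≤ ‖(k : ℚ_[p])‖ * 1 := by gcongr
    _ = ‖(k : ℚ_[p])‖ := mul_one _

/-- **`‖L(1−k, χ_D)‖_p ≤ 1` from the value `−1` at some `c ≡ 1 (mod p)`** (Carlitz's case «conductor not a power of `p`»: `1 − χ_D(c)c^k =
1 + c^k ≡ 2` is a unit). [cite: Carlitz1959, Theorem (integrality of k⁻¹B_{k,χ})] [cite: BillereyMenares2018, proof of Lemma 3] -/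
theorem norm_lValueDisc_le_one_of_apply_eq_neg_one (hp2 : p ≠ 2) {D : ℤ} (hD : D % 4 = 1 ∨ 4 ∣ D) (hD0 : D ≠ 0) {k c : ℕ} (hk : 1 ≤ k)
    (hc : c.Coprime (D.natAbs * p)) (hco : D % 4 = 1 ∨ Odd c) (hc1 : (c : ZMod p) = 1) (hval : chiDisc D c = -1) :
    ‖((lValueDisc k D : ℚ) : ℚ_[p])‖ ≤ 1 := by
  haveI : NeZero D.natAbs := ⟨Int.natAbs_ne_zero.mpr hD0⟩
  set θ : ℕ → ℤ_[p] := fun b ↦ ((chiDisc D b : ℤ) : ℤ_[p]) with hθ_def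
  have hθ : ∀ b, θ (b + D.natAbs) = θ b := fun b ↦ by simp only [hθ_def, chiDisc_add_natAbs hD hD0]
  have hθc : ∀ x, θ (c * x) = θ c * θ x := fun x ↦ by
    simp only [hθ_def, chiDisc_mul_right hco]; push_cast; ring
  have hθm : θ c = -1 := by simp only [hθ_def, hval, Int.cast_neg, Int.cast_one]
  have h := CarlitzIntegrality.norm_sum_mul_bernoulliDist_div_le_one_of_apply_eq_neg_one hp2 hc hθ hθc hk hc1 hθm
  have hsum : ∑ b : ZMod D.natAbs, ((θ b.val : ℤ_[p]) : ℚ_[p]) * ((bernoulliDist k D.natAbs b : ℚ) : ℚ_[p]) =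
      ((bernoulliDisc k D : ℚ) : ℚ_[p]) := by
    rw [ratCast_bernoulliDisc_eq_sum hk D]
    refine Finset.sum_congr rfl fun b _ => ?_
    simp only [hθ_def, PadicInt.coe_intCast]
  have hkp : ‖(k : ℚ_[p])‖ ≠ 0 := by
    rw [norm_ne_zero_iff]; exact_mod_cast (show k ≠ 0 by omega)
  rw [hsum] at h
  rw [lValueDisc, Rat.cast_div, Rat.cast_neg, Rat.cast_natCast, norm_div, norm_neg, div_le_one (lt_of_le_of_ne (norm_nonneg _) hkp.symm)]
  rw [norm_mul, norm_inv] at h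
  calc ‖((bernoulliDisc k D : ℚ) : ℚ_[p])‖ = ‖(k : ℚ_[p])‖ * (‖(k : ℚ_[p])‖⁻¹ * ‖((bernoulliDisc k D : ℚ) : ℚ_[p])‖) := by
        field_simp
    _ ≤ ‖(k : ℚ_[p])‖ * 1 := by gcongr
    _ = ‖(k : ℚ_[p])‖ := mul_one _

/-! ## §3 The auxiliary `c`, case by case -/

/-- **`p ∤ D`**: `‖L(1−k, χ_D)‖_p ≤ 1` for `2 ≤ k ≤ p − 2` (auxiliary `c ≡ 1 (mod |D|)`, a primitive root mod `p`: `χ_D(c) = χ_D(1) = 1` by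
periodicity, `p ∤ 1 − c^k`; covers `D = 1`, where `L(1−k, χ_1) = −B_k/k`). [cite: LangCyclotomic1990, Ch. 2 §2, Thm. 2.4] [cite: Washington1997, Cor. 5.15] -/
theorem norm_lValueDisc_le_one_of_not_dvd_disc (hp2 : p ≠ 2) {D : ℤ} (hD : D % 4 = 1 ∨ 4 ∣ D) (hD0 : D ≠ 0)
    (hpD : ¬ (p : ℤ) ∣ D) {k : ℕ} (hk : 2 ≤ k) (hkp : k ≤ p - 2) : ‖((lValueDisc k D : ℚ) : ℚ_[p])‖ ≤ 1 := by
  have hpp : p.Prime := hp.out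
  haveI : NeZero D.natAbs := ⟨Int.natAbs_ne_zero.mpr hD0⟩
  have hpN : ¬ p ∣ D.natAbs := fun h => hpD (Int.natCast_dvd.mpr h)
  have hNp : D.natAbs.Coprime p := Nat.Coprime.symm ((Nat.Prime.coprime_iff_not_dvd hpp).mpr hpN)
  obtain ⟨c, hc, hc1, hck⟩ := CharacterTwist.exists_auxiliary (p := p) hNp
  have hc' : c.Coprime (D.natAbs * p) := Nat.Coprime.coprime_dvd_right ⟨p, by ring⟩ hc
  have hcN : c.Coprime D.natAbs := Nat.Coprime.coprime_dvd_right ⟨p * p, by ring⟩ hc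
  -- `c` is odd when `4 ∣ D`
  have hco : D % 4 = 1 ∨ Odd c := by
    rcases hD with h | ⟨D', hD'⟩
    · exact Or.inl h
    · right
      have h2N : 2 ∣ D.natAbs := ⟨2 * D'.natAbs, by rw [hD', Int.natAbs_mul]; simp; ring⟩
      refine Nat.odd_iff.mpr ((Nat.mod_two_eq_zero_or_one c).resolve_left fun h0 => ?_)
      have h2c : 2 ∣ c := Nat.dvd_of_mod_eq_zero h0
      have h2 : 2 ∣ Nat.gcd c D.natAbs := Nat.dvd_gcd h2c h2N
      rw [hcN] at h2
      omega
  -- `χ_D(c) = χ_D(1) = 1`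
  have hval : chiDisc D c = 1 := by
    have hmod : c % D.natAbs = 1 % D.natAbs := (ZMod.natCast_eq_natCast_iff' c 1 D.natAbs).mp (by simpa using hc1)
    rw [← chiDisc_mod_natAbs hD hD0 c, hmod, chiDisc_mod_natAbs hD hD0 1, chiDisc_one_right]
  -- `1 − c^k` is a unit
  have hu : ‖1 - ((chiDisc D c : ℤ) : ℚ_[p]) * (c : ℚ_[p]) ^ k‖ = 1 := by
    have hnd := hck k (by omega) (by omega)
    rw [hval, show (1 : ℚ_[p]) - (((1 : ℤ) : ℤ) : ℚ_[p]) * (c : ℚ_[p]) ^ k = (((1 - (c : ℤ) ^ k : ℤ)) : ℚ_[p]) by push_cast; ring]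
    exact le_antisymm (Padic.norm_int_le_one _) (not_lt.mp fun h => hnd (Padic.norm_intCast_lt_one_iff.mp h))
  exact norm_lValueDisc_le_one_of_unit hp2 hD hD0 (by omega) hc' hco hu

/-- **`p ∣ D`, `D` odd and NEGATIVE** (`D = −n₀`, `n₀ ≡ 3 (mod 4)` squarefree, `p ∣ n₀`): the tree's level-one Carlitz bound with the exponent
conditions `(p−1) ∤ k`, `(p−1) ∤ 2k` (which also settle `D = −p`). [cite: Carlitz1959, Theorem (integrality of k⁻¹B_{k,χ})] -/
theorem norm_lValueDisc_le_one_of_dvd_of_neg (hp2 : p ≠ 2) {D : ℤ} (hD4 : D % 4 = 1) (hsq : Squarefree D) (hneg : D < 0)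
    (hpD : (p : ℤ) ∣ D) {k : ℕ} (hk : 2 ≤ k) (hkp : k ≤ p - 2) (hk2 : ¬ (p - 1) ∣ 2 * k) :
    ‖((lValueDisc k D : ℚ) : ℚ_[p])‖ ≤ 1 := by
  have hpp : p.Prime := hp.out
  have hDeq : D = -(D.natAbs : ℤ) := by rw [Int.ofNat_natAbs_of_nonpos hneg.le]; ring
  have h4 : D.natAbs % 4 = 3 := by omega
  have hsqN : Squarefree D.natAbs := Int.squarefree_natAbs.mpr hsq
  have hpN : p ∣ D.natAbs := Int.natCast_dvd.mp hpD
  have hk1 : ¬ (p - 1) ∣ k := fun h => by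
    have := Nat.le_of_dvd (by omega) h
    omega
  rw [hDeq]
  exact norm_lValueDisc_neg_le_one_of_dvd_of_not_dvd hp2 hsqN h4 (by omega) hpN hk1 hk2

/-- **`p ∣ D`, `D` odd and POSITIVE, `p ≡ 3 (mod 4)`**: `D = p·n` with `n ≡ 3 (mod 4)`; the auxiliary `c ≡ 1 (mod p)`, `c ≡ −1 (mod n)` has
`χ_D(c) = J(c | p)·J(c | n) = −1`. [cite: Carlitz1959, Theorem (integrality of k⁻¹B_{k,χ})] [cite: BillereyMenares2018, proof of Lemma 3] -/
theorem norm_lValueDisc_le_one_of_dvd_of_pos (hp2 : p ≠ 2) (hp4 : p % 4 = 3) {D : ℤ} (hD4 : D % 4 = 1) (hsq : Squarefree D)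
    (hpos : 0 < D) (hpD : (p : ℤ) ∣ D) {k : ℕ} (hk : 2 ≤ k) : ‖((lValueDisc k D : ℚ) : ℚ_[p])‖ ≤ 1 := by
  have hpp : p.Prime := hp.out
  have hD0 : D ≠ 0 := hpos.ne'
  have hDN : (D.natAbs : ℤ) = D := Int.natAbs_of_nonneg hpos.le
  obtain ⟨n, hn⟩ : p ∣ D.natAbs := Int.natCast_dvd.mp hpD
  have hsqN : Squarefree D.natAbs := Int.squarefree_natAbs.mpr hsq
  have hn4 : n % 4 = 3 := by
    have hDmod : D.natAbs % 4 = 1 := by omega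
    rw [hn, Nat.mul_mod, hp4] at hDmod
    have : n % 4 < 4 := Nat.mod_lt _ (by norm_num)
    interval_cases h : n % 4 <;> omega
  have hn0 : n ≠ 0 := by rintro rfl; norm_num at hn4
  haveI : NeZero n := ⟨hn0⟩
  haveI : NeZero p := ⟨hpp.ne_zero⟩
  have hpn : Nat.Coprime p n := by
    refine (Nat.Prime.coprime_iff_not_dvd hpp).mpr fun ⟨t, ht⟩ => ?_
    exact Nat.squarefree_iff_prime_squarefree.mp hsqN p hpp ⟨t, by rw [hn, ht]; ring⟩
  obtain ⟨c, hc1, hc2⟩ := Nat.chineseRemainder hpn 1 (n - 1)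
  have hcp : c.Coprime p := by rw [Nat.Coprime, hc1.gcd_eq]; exact Nat.coprime_one_left p
  have hcn : c.Coprime n := by
    rw [Nat.Coprime, hc2.gcd_eq]
    have h := (Nat.coprime_self_add_left (m := n - 1) (n := 1)).mpr (Nat.coprime_one_left _)
    rw [Nat.sub_add_cancel (show 1 ≤ n by omega)] at h
    exact Nat.coprime_comm.mp h
  have hc : c.Coprime (D.natAbs * p) := by
    rw [hn]; exact (Nat.Coprime.mul_right hcp hcn).mul_right hcp
  have hcmod : (c : ZMod p) = 1 := by
    have := (ZMod.natCast_eq_natCast_iff' c 1 p).mpr hc1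
    simpa using this
  have hval : chiDisc D c = -1 := by
    rw [chiDisc_of_emod_four_eq_one hD4, hn, jacobiSym.mul_right, jacobiSym.mod_left' (a₂ := 1) (by exact_mod_cast hc1),
      jacobiSym.one_left, one_mul, jacobiSym.mod_left' (a₂ := ((n - 1 : ℕ) : ℤ)) (by exact_mod_cast hc2),
      jacobiSym_pred_eq_neg_one hn4]
  exact norm_lValueDisc_le_one_of_apply_eq_neg_one hp2 (Or.inl hD4) hD0 (by omega) hc (Or.inl hD4) hcmod hval

/-- **`p ∣ D`, `D = 4D'` with `D' ≡ 3 (mod 4)`**: the auxiliary `c ≡ 1 (mod |D'|)`, `c ≡ 3 (mod 4)` has `χ_D(c) = J(D' | c) = χ₄(c)·J(c | |D'|) = −1`.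
[cite: Carlitz1959, Theorem (integrality of k⁻¹B_{k,χ})] [cite: MontgomeryVaughan2007, Thm. 9.13] -/
theorem norm_lValueDisc_le_one_of_dvd_of_four_mul_three (hp2 : p ≠ 2) {D' : ℤ} (hD'4 : D' % 4 = 3) (hpD : (p : ℤ) ∣ D')
    {k : ℕ} (hk : 2 ≤ k) : ‖((lValueDisc k (4 * D') : ℚ) : ℚ_[p])‖ ≤ 1 := by
  have hpp : p.Prime := hp.out
  have hD'0 : D' ≠ 0 := by rintro rfl; norm_num at hD'4
  have hD0 : 4 * D' ≠ 0 := mul_ne_zero (by norm_num) hD'0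
  have hD1 : (4 * D') % 4 ≠ 1 := by omega
  set M := D'.natAbs with hM
  have hModd : M % 2 = 1 := by omega
  have h4M : Nat.Coprime M 4 := by
    have : Nat.Coprime M 2 := (Nat.coprime_comm).mp ((Nat.Prime.coprime_iff_not_dvd Nat.prime_two).mpr (by omega))
    simpa using this.pow_right 2
  obtain ⟨c, hc1, hc2⟩ := Nat.chineseRemainder h4M 1 3
  have hc4 : c % 4 = 3 := hc2
  have hcodd : Odd c := Nat.odd_iff.mpr (by omega)
  have hpM : p ∣ M := Int.natCast_dvd.mp hpD; have hcM : c.Coprime M := by rw [Nat.Coprime, hc1.gcd_eq]; exact Nat.coprime_one_left M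
  have hcp : c.Coprime p := Nat.Coprime.coprime_dvd_right hpM hcM
  have hc2' : c.Coprime 2 := (Nat.coprime_comm).mp ((Nat.Prime.coprime_iff_not_dvd Nat.prime_two).mpr (by omega))
  have hc : c.Coprime ((4 * D').natAbs * p) := by
    rw [Int.natAbs_mul, show (4 : ℤ).natAbs = 2 ^ 2 by rfl]
    exact ((hc2'.pow_right 2).mul_right hcM).mul_right hcp
  have hcmod : (c : ZMod p) = 1 := by
    have := (ZMod.natCast_eq_natCast_iff' c 1 p).mpr (hc1.of_dvd hpM)
    simpa using this
  -- the value `χ_{4D'}(c) = χ₄(c) · J(c | |D'|) = −1`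
  have hE4 : (-D') % 4 = 1 := by omega
  have hval : chiDisc (4 * D') c = -1 := by
    rw [chiDisc_of_emod_four_ne_one_of_odd hD1 hcodd, jacobiSym_four_mul_of_odd D' hcodd,
      show D' = -1 * -D' by ring, jacobiSym.mul_left, jacobiSym.at_neg_one hcodd, ZMod.χ₄_nat_three_mod_four hc4,
      ← jacobiSym_natAbs_eq_of_emod_four_eq_one hE4 hcodd, Int.natAbs_neg, ← hM,
      jacobiSym.mod_left' (a₂ := 1) (by exact_mod_cast hc1), jacobiSym.one_left]
    norm_num
  exact norm_lValueDisc_le_one_of_apply_eq_neg_one hp2 (Or.inr (dvd_mul_right 4 D')) hD0 (by omega) hc (Or.inr hcodd) hcmod hval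

/-- **`p ∣ D`, `D = 8D''` with `D''` odd**: the auxiliary `c ≡ 1 (mod |D''|)`, `c ≡ 5 (mod 8)` has
`χ_D(c) = J(2 | c)·J(D'' | c) = χ₈(5)·1 = −1` (`J(D'' | c) = J(c | |D''|)` or `χ₄(c)·J(c | |D''|)`, both `= 1` at `c ≡ 1 (4)`).
[cite: Carlitz1959, Theorem (integrality of k⁻¹B_{k,χ})] [cite: MontgomeryVaughan2007, Thm. 9.13] -/
theorem norm_lValueDisc_le_one_of_dvd_of_eight_mul (hp2 : p ≠ 2) {D'' : ℤ} (hodd : D'' % 2 = 1 ∨ D'' % 2 = -1 ∨ Odd D'')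
    (hpD : (p : ℤ) ∣ D'') {k : ℕ} (hk : 2 ≤ k) : ‖((lValueDisc k (8 * D'') : ℚ) : ℚ_[p])‖ ≤ 1 := by
  have hpp : p.Prime := hp.out
  have hodd' : Odd D'' := by
    rcases hodd with h | h | h
    · exact Int.odd_iff.mpr h
    · exact Int.odd_iff.mpr (by omega)
    · exact h
  have hD''2 : D'' % 2 = 1 := Int.odd_iff.mp hodd'
  have hD''0 : D'' ≠ 0 := by rintro rfl; norm_num at hD''2
  have hD0 : 8 * D'' ≠ 0 := mul_ne_zero (by norm_num) hD''0
  have hD1 : (8 * D'') % 4 ≠ 1 := by omega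
  set M := D''.natAbs with hM
  have hModd : M % 2 = 1 := by omega
  have h8M : Nat.Coprime M 8 := by
    have : Nat.Coprime M 2 := (Nat.coprime_comm).mp ((Nat.Prime.coprime_iff_not_dvd Nat.prime_two).mpr (by omega))
    simpa using this.pow_right 3
  obtain ⟨c, hc1, hc2⟩ := Nat.chineseRemainder h8M 1 5
  have hc8 : c % 8 = 5 := hc2
  have hcodd : Odd c := Nat.odd_iff.mpr (by omega)
  have hpM : p ∣ M := Int.natCast_dvd.mp hpD
  have hcM : c.Coprime M := by rw [Nat.Coprime, hc1.gcd_eq]; exact Nat.coprime_one_left M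
  have hcp : c.Coprime p := Nat.Coprime.coprime_dvd_right hpM hcM
  have hc2' : c.Coprime 2 := (Nat.coprime_comm).mp ((Nat.Prime.coprime_iff_not_dvd Nat.prime_two).mpr (by omega))
  have hc : c.Coprime ((8 * D'').natAbs * p) := by
    rw [Int.natAbs_mul, show (8 : ℤ).natAbs = 2 ^ 3 by rfl]
    exact ((hc2'.pow_right 3).mul_right hcM).mul_right hcp
  have hcmod : (c : ZMod p) = 1 := by
    have := (ZMod.natCast_eq_natCast_iff' c 1 p).mpr (hc1.of_dvd hpM)
    simpa using this
  -- `J(c | |D''|) = 1`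
  have hJM : J((c : ℤ) | M) = 1 := by
    rw [jacobiSym.mod_left' (a₂ := 1) (by exact_mod_cast hc1), jacobiSym.one_left]
  -- `J(D'' | c) = 1`: by reciprocity directly if `D'' ≡ 1 (4)`, through `χ₄(c) = 1` if `D'' ≡ 3 (4)`
  have hJD'' : J(D'' | c) = 1 := by
    rcases (show D'' % 4 = 1 ∨ D'' % 4 = 3 by omega) with h1 | h3
    · rw [← jacobiSym_natAbs_eq_of_emod_four_eq_one h1 hcodd, ← hM, hJM]
    · have hE4 : (-D'') % 4 = 1 := by omega
      rw [show D'' = -1 * -D'' by ring, jacobiSym.mul_left, jacobiSym.at_neg_one hcodd, ZMod.χ₄_nat_one_mod_four (by omega),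
        ← jacobiSym_natAbs_eq_of_emod_four_eq_one hE4 hcodd, Int.natAbs_neg, ← hM, hJM]
      norm_num
  have hval : chiDisc (8 * D'') c = -1 := by
    rw [chiDisc_of_emod_four_ne_one_of_odd hD1 hcodd, show (8 : ℤ) * D'' = 4 * (2 * D'') by ring, jacobiSym_four_mul_of_odd _ hcodd,
      jacobiSym.mul_left, hJD'', mul_one, jacobiSym.at_two hcodd, ZMod.χ₈_nat_eq_if_mod_eight]
    have hc2m : c % 2 = 1 := by omega
    simp [hc8, hc2m]
  exact norm_lValueDisc_le_one_of_apply_eq_neg_one hp2 (Or.inr ⟨2 * D'', by ring⟩) hD0 (by omega) hc (Or.inr hcodd) hcmod hval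

/-! ## §4 Every fundamental discriminant (or `1`) -/

/-- **`L(1 − k, χ_D)` is `p`-integral for every `D` which is `1` or a fundamental discriminant** (`p ≡ 3 (mod 4)` an odd prime,
`2 ≤ k ≤ p − 2`, `(p − 1) ∤ 2k`; the discriminant predicate spelled as in `IsDiscDecomposition`). [cite: Carlitz1959, Theorem (integrality of k⁻¹B_{k,χ})]
[cite: Washington1997, Thm. 5.11 and Cor. 5.15] -/
theorem norm_lValueDisc_le_one_of_isDisc (hp2 : p ≠ 2) (hp4 : p % 4 = 3) {D : ℤ}
    (hD : D = 1 ∨ (D % 4 = 1 ∧ Squarefree D ∧ D ≠ 1) ∨ (4 ∣ D ∧ (D / 4 % 4 = 2 ∨ D / 4 % 4 = 3) ∧ Squarefree (D / 4)))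
    {k : ℕ} (hk : 2 ≤ k) (hkp : k ≤ p - 2) (hk2 : ¬ (p - 1) ∣ 2 * k) : ‖((lValueDisc k D : ℚ) : ℚ_[p])‖ ≤ 1 := by
  have hpp : p.Prime := hp.out
  have hshape : D % 4 = 1 ∨ 4 ∣ D := by
    rcases hD with rfl | ⟨h, -, -⟩ | ⟨h, -, -⟩
    · left; decide
    · exact Or.inl h
    · exact Or.inr h
  have hD0 : D ≠ 0 := by
    rcases hD with rfl | ⟨h, -, -⟩ | ⟨-, h23, hsq⟩
    · norm_num
    · omega
    · rintro rfl
      norm_num at h23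
  by_cases hpD : (p : ℤ) ∣ D
  swap
  · exact norm_lValueDisc_le_one_of_not_dvd_disc hp2 hshape hD0 hpD hk hkp
  rcases hD with rfl | ⟨h4, hsq, -⟩ | ⟨h4dvd, h23, hsq⟩
  · -- `D = 1`: `p ∤ 1`
    exfalso
    have := Int.eq_one_of_dvd_one (by exact_mod_cast hpp.pos.le) hpD
    exact hpp.one_lt.ne' (by exact_mod_cast this)
  · -- odd `D`
    rcases lt_or_gt_of_ne hD0 with hneg | hpos
    · exact norm_lValueDisc_le_one_of_dvd_of_neg hp2 h4 hsq hneg hpD hk hkp hk2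
    · exact norm_lValueDisc_le_one_of_dvd_of_pos hp2 hp4 h4 hsq hpos hpD hk
  · -- even `D = 4·D'`
    obtain ⟨D', rfl⟩ := h4dvd
    have hD'eq : 4 * D' / 4 = D' := by simp
    rw [hD'eq] at h23 hsq
    have hp4Z : ¬ (p : ℤ) ∣ 4 := fun h => by
      have h' : p ∣ 4 := by exact_mod_cast h
      have : p ≤ 4 := Nat.le_of_dvd (by norm_num) h'
      interval_cases p <;> simp_all (config := {decide := true})
    have hpD' : (p : ℤ) ∣ D' :=
      (Int.Prime.dvd_mul' hpp hpD).resolve_left hp4Z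
    rcases h23 with h2 | h3
    · -- `D' = 2·D''`, `D''` odd
      obtain ⟨D'', rfl⟩ : (2 : ℤ) ∣ D' := by omega
      have hD''odd : D'' % 2 = 1 ∨ D'' % 2 = -1 ∨ Odd D'' := by
        left
        have h2 : ¬ (2 : ℤ) ∣ D'' := fun ⟨t, ht⟩ => by
          have hu := hsq 2 ⟨t, by rw [ht]; ring⟩
          rw [Int.isUnit_iff] at hu
          omega
        omega
      have hp2Z : ¬ (p : ℤ) ∣ 2 := fun h => by
        have h' : p ∣ 2 := by exact_mod_cast h
        exact hp2 ((Nat.prime_dvd_prime_iff_eq hpp Nat.prime_two).mp h')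
      have hpD'' : (p : ℤ) ∣ D'' := (Int.Prime.dvd_mul' hpp hpD').resolve_left hp2Z
      rw [show (4 : ℤ) * (2 * D'') = 8 * D'' by ring]
      exact norm_lValueDisc_le_one_of_dvd_of_eight_mul hp2 hD''odd hpD'' hk
    · exact norm_lValueDisc_le_one_of_dvd_of_four_mul_three hp2 h3 hpD' hk

end Summit.BirchSwinnertonDyer.BirchSwinnertonDyer.Theorems.PrintCFram.CohenCut

end
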